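import Mathlib
import HarnessLib
import Summits.AtomisticToContinuum.FouriersLaw.Theses.TangentFlowDephasing

/-!
# Birth skeleton (BC3) for crux `TangentFlowDephasing.NoSelfLocalization`
(item `stmt-AtomisticToContinuum-12158`, route `route-AtomisticToContinuum-TangentFlowDephasing`, crux rank 4;
sub-problem `FouriersLaw`; registrar `planner-skel-stmt-AtomisticToContinuum-12158-0`, 2026-08-17)

Crux (FIXED, concluded BY NAME below): for `pinnedChain ω₂ lam β γ` (all `> 0`), `T > 0`, every
SHIFT-INVARIANT DLR Gibbs state `μ` and every `μ`-preserving infinite-volume dynamics `D` with absolutely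
convergent current correlations: `C_T ∈ L¹(0,∞) ⇒ 0 < κ_GK = (T²)⁻¹ ∫_0^∞ C_T`.

## Line `birth` — EINSTEIN–HELFAND: positivity of the Green–Kubo integral = diffusive spreading of energy

Write `C = D.currentCorrelation μ`, `j_x = bondCurrentZ`, `Q_x(t)(σ) = ∫_0^t j_x(φ_s σ) ds` (time-integrated
current through bond `x`), and `V(t) = Σ_x ∫ Q_0(t) Q_x(t) dμ` (covariance of integrated currents = by the
continuity equation the growth of the mean-square displacement of the energy, Helfand's moment).

* `stub_currentCorrelation_even` (STATIONARITY × TRANSLATION SYMMETRY): `C(−t) = C(t)`.  This is where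
  `IsShiftInvariant μ` is consumed (Koopman isometry of `φ_t` on `L²(μ)` + `j_x = j_0 ∘ shift^x` + shift
  covariance of the flow `μ`-a.e.; the refuter's hygiene remark §G — covariance is not a field of
  `InfiniteChainDynamics` — must be settled HERE, from uniqueness on the shift-saturated carrier or by the
  momentum reversal `(q,p) ↦ (q,−p)`).  Size M/L.
* `stub_einsteinHelfand` (FINITE-TIME EINSTEIN–HELFAND IDENTITY; no decay assumed): for even `C` and every
  `t > 0`, `V(t) = 2∫_{(0,t]} (t − u) C(u) du` (`= ∫_{−t}^{t} (t − |r|) C(r) dr`, the doubly integrated form of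
  `InfiniteChainCurrentPositiveType.currentCorrelation_positiveType`): Fubini over
  `[0,t]² × Ω` (joint measurability of `(s,σ) ↦ j_x(φ_s σ)` from continuity of orbits; `j_x ∈ L²(μ)` from
  `HasAbsConvergentCorrelation μ 0`), stationarity `∫ (j_0∘φ_u)(j_x∘φ_s) dμ = c_x(s−u)` and the exchange of
  `Σ_x` with `∫∫` (locality of the correlations on compact time windows).  Size L.
* `stub_diffusiveSpreading` (NO DYNAMICAL LOCALISATION OF THE ENERGY — the physical content): there is
  `c > 0` with `c·t ≤ V(t)` for all large `t`: the integrated energy current through the origin fluctuates at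
  least diffusively (mean-square energy displacement `σ²(t) ≥ σ²(0) + c t`).  `V(t)` is a VARIANCE functional
  (`= lim_Λ |Λ|⁻¹ Var_μ Q_Λ(t) ≥ 0`), so it admits projection (Cauchy–Schwarz-from-below / Mazur-type) lower
  bounds and Guarneri-type transport lower bounds from spectral continuity of the Liouvillian on the energy
  sector — none of which is available for the signed integral `∫_0^∞ C`.  Open; size XL.
* COMPOSITION `noSelfLocalization_of_stubs` (sorry-free, the real proof): the identity (with evenness) and the
  calculus lemma `integral_Ioi_max_sub_mul` give `V(t)/t = ∫_0^∞ (1 − r/t)⁺ 2C(r) dr`; dominated convergence (`|…| ≤ 2|C| ∈ L¹`) gives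
  `V(t)/t → 2∫_0^∞ C`; the diffusive lower bound gives `c ≤ 2∫_0^∞ C`, hence `0 < ∫_0^∞ C` and
  `0 < (T²)⁻¹ ∫_0^∞ C = κ_GK`.  `NoSelfLocalization_of` is this term at the crux's NAME.
-/

noncomputable section

namespace Summit.AtomisticToContinuum.FouriersLaw.Cruxes.NoSelfLocalization

namespace Birth

open MeasureTheory Filter Set

/-! ## The three registered stubs -/

/-- **stub 1 — `stub_currentCorrelation_even` (time-reflection symmetry of the space-summed current
autocorrelation).**  For `pinnedChain ω₂ lam β γ` (all `> 0`), `T > 0`, a shift-invariant DLR Gibbs state `μ`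
and a `μ`-preserving dynamics `D` with absolutely convergent current correlations at every time:
`C(−t) = C(t)` for every `t`, `C = D.currentCorrelation μ`.  Mechanism: `∫ j_0 (j_x∘φ_{−t}) dμ =
∫ (j_0∘φ_t) j_x dμ` (invariance of `μ` under `φ_t`, group law on the carrier), then `j_x = j_0 ∘ shift^x`,
shift-invariance of `μ` and shift-covariance of the flow `μ`-a.e. re-index the sum over `x`. -/
theorem stub_currentCorrelation_even :
    ∀ ω₂ lam β γ : ℝ, 0 < ω₂ → 0 < lam → 0 < β → 0 < γ → ∀ T : ℝ, 0 < T → ∀ (μ : MeasureTheory.Measure Literature.MathematicalPhysics.KineticTheory.HeatConduction.ChainConfig) (D : Literature.MathematicalPhysics.KineticTheory.HeatConduction.InfiniteChainDynamics (Literature.MathematicalPhysics.KineticTheory.HeatConduction.pinnedChain ω₂ lam β γ)), (Literature.MathematicalPhysics.KineticTheory.HeatConduction.pinnedChain ω₂ lam β γ).IsChainGibbsMeasure T μ → Literature.MathematicalPhysics.KineticTheory.HeatConduction.IsShiftInvariant μ → D.PreservesMeasure μ → (∀ t : ℝ, D.HasAbsConvergentCorrelation μ t) → ∀ t : ℝ,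 D.currentCorrelation μ (-t) = D.currentCorrelation μ t := by
  sorry

/-- **stub 2 — `stub_einsteinHelfand` (finite-time Einstein–Helfand identity).**  Same carrier hypotheses;
if moreover `C = D.currentCorrelation μ` is even, then for every `t > 0` the covariance of the time-integrated
bond currents `Q_x(t) = ∫_0^t j_x ∘ φ_s ds` satisfies
`Σ_x ∫ Q_0(t) Q_x(t) dμ = 2 ∫_{(0,t]} (t − u) C(u) du` (`= ∫_{−t}^{t} (t − |r|) C(r) dr = ∫_0^t ∫_0^t C(s−u) du ds`;
the right-hand side is the doubly integrated form whose NON-NEGATIVITY is the tree's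
`InfiniteChainDynamics.currentCorrelation_positiveType`, Literature/…/InfiniteChainCurrentPositiveType.lean).
No decay of `C` is assumed: this is a finite-time identity.
Content: Fubini on `[0,t]² × Ω` (orbits are solutions, hence continuous in `s`; `j_x ∈ L²(μ)` from the
`t = 0` instance of `HasAbsConvergentCorrelation`), stationarity `∫ (j_0∘φ_u)(j_x∘φ_s) dμ = c_x(s − u)`, and the
exchange of `Σ_x` with the time integrals. -/
theorem stub_einsteinHelfand :
    ∀ ω₂ lam β γ : ℝ, 0 < ω₂ → 0 < lam → 0 < β → 0 < γ → ∀ T : ℝ, 0 < T → ∀ (μ : MeasureTheory.Measure Literature.MathematicalPhysics.KineticTheory.HeatConduction.ChainConfig) (D : Literature.MathematicalPhysics.KineticTheory.HeatConduction.InfiniteChainDynamics (Literature.MathematicalPhysics.KineticTheory.HeatConduction.pinnedChain ω₂ lam β γ)), (Literature.MathematicalPhysics.KineticTheory.HeatConduction.pinnedChain ω₂ lam β γ).IsChainGibbsMeasure T μ → Literature.MathematicalPhysics.KineticTheory.HeatConduction.IsShiftInvariant μ → D.PreservesMeasure μ → (∀ t : ℝ, D.HasAbsConvergentCorrelation μ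 t) → (∀ t : ℝ, D.currentCorrelation μ (-t) = D.currentCorrelation μ t) → ∀ t : ℝ, 0 < t → (∑' x : ℤ, ∫ σ, (∫ s in (0:ℝ)..t, (Literature.MathematicalPhysics.KineticTheory.HeatConduction.pinnedChain ω₂ lam β γ).bondCurrentZ (D.flow s σ) 0) * (∫ s in (0:ℝ)..t, (Literature.MathematicalPhysics.KineticTheory.HeatConduction.pinnedChain ω₂ lam β γ).bondCurrentZ (D.flow s σ) x) ∂μ) = 2 * ∫ u in Set.Ioc (0:ℝ) t, (t - u) * D.currentCorrelation μ u := by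
  sorry

/-- **stub 3 — `stub_diffusiveSpreading` (no dynamical localisation of the energy: Einstein–Helfand
diffusivity bounded below).**  Same carrier hypotheses; then there is `c > 0` such that for all sufficiently
large `t` the covariance of the time-integrated bond currents obeys `c · t ≤ Σ_x ∫ Q_0(t) Q_x(t) dμ` — the
energy transported across the origin in time `t` has at least DIFFUSIVE fluctuations (equivalently, by the
continuity equation `ė_x = j_{x−1} − j_x`, the mean-square displacement of the energy grows at least linearly).
This is the physical content of the crux in variance form (`Σ_x ∫ Q_0 Q_x dμ = lim_Λ |Λ|⁻¹ Var_μ Q_Λ(t) ≥ 0`):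
an insulating (self-localised) phase of the pinned anharmonic chain is exactly `V(t) = o(t)`. -/
theorem stub_diffusiveSpreading :
    ∀ ω₂ lam β γ : ℝ, 0 < ω₂ → 0 < lam → 0 < β → 0 < γ → ∀ T : ℝ, 0 < T → ∀ (μ : MeasureTheory.Measure Literature.MathematicalPhysics.KineticTheory.HeatConduction.ChainConfig) (D : Literature.MathematicalPhysics.KineticTheory.HeatConduction.InfiniteChainDynamics (Literature.MathematicalPhysics.KineticTheory.HeatConduction.pinnedChain ω₂ lam β γ)), (Literature.MathematicalPhysics.KineticTheory.HeatConduction.pinnedChain ω₂ lam β γ).IsChainGibbsMeasure T μ → Literature.MathematicalPhysics.KineticTheory.HeatConduction.IsShiftInvariant μ → D.PreservesMeasure μ → (∀ t : ℝ, D.HasAbsConvergentCorrelation μ t) → ∃ c : ℝ, 0 < c ∧ ∀ᶠ t : ℝ in Filter.atTop, c * t ≤ ∑' x : ℤ, ∫ σ, (∫ s in (0:ℝ)..t, (Literature.MathematicalPhysics.KineticTheory.HeatConduction.pinnedChain ω₂ lam β γ).bondCurrentZ (D.flow s σ) 0) * (∫ s in (0:ℝ)..t, (Literature.MathematicalPhysics.KineticTheory.HeatConduction.pinnedChain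 ω₂ lam β γ).bondCurrentZ (D.flow s σ) x) ∂μ := by
  sorry

/-! ## A calculus lemma for the composition (sorry-free) -/

/-- `∫_{(0,∞)} (t - r)⁺ · f(r) dr = ∫_{(0,t]} (t - r) · f(r) dr`: the integrand vanishes past `t`. -/
theorem integral_Ioi_max_sub_mul (f : ℝ → ℝ) (t : ℝ) :
    (∫ r in Set.Ioi (0:ℝ), max (t - r) 0 * f r) = ∫ r in Set.Ioc (0:ℝ) t, (t - r) * f r := by
  have h1 : (∫ r in Set.Ioi (0:ℝ), max (t - r) 0 * f r)
      = ∫ r in Set.Ioi (0:ℝ), Set.indicator (Set.Iic t) (fun r => (t - r) * f r) r := by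
    refine MeasureTheory.setIntegral_congr_fun measurableSet_Ioi (fun r _ => ?_)
    by_cases hrt : r ≤ t
    · rw [Set.indicator_of_mem (Set.mem_Iic.mpr hrt), max_eq_left (sub_nonneg.mpr hrt)]
    · have hlt : t < r := lt_of_not_ge hrt
      rw [Set.indicator_of_notMem (fun h => hrt (Set.mem_Iic.mp h)), max_eq_right (by linarith),
        zero_mul]
  rw [h1, MeasureTheory.integral_indicator measurableSet_Iic,
    MeasureTheory.Measure.restrict_restrict measurableSet_Iic, Set.inter_comm, Set.Ioi_inter_Iic]

/-! ## The composition (sorry-free) -/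

/-- **The implication, sorry-free**: `stub_currentCorrelation_even`-statement → `stub_einsteinHelfand`-statement →
`stub_diffusiveSpreading`-statement → the statement of `TangentFlowDephasing.NoSelfLocalization` (conclusion = the
crux's definiens VERBATIM, so that `NoSelfLocalization_of` below is this term at the crux's name).  Proof:
the Einstein–Helfand identity (fed with the evenness stub) and `integral_Ioi_max_sub_mul` give
`V(t)/t = ∫_0^∞ (1 − r/t)⁺ 2C(r) dr`; dominated convergence (`≤ 2|C| ∈ L¹(0,∞)`, the crux's hypothesis, used only
here) gives `V(t)/t → 2∫_0^∞ C`; the diffusive bound `c t ≤ V(t)` eventually gives `c ≤ 2∫_0^∞ C`, so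
`0 < ∫_0^∞ C` and `0 < (T²)⁻¹ ∫_0^∞ C`. -/
theorem noSelfLocalization_of_stubs :
    (∀ ω₂ lam β γ : ℝ, 0 < ω₂ → 0 < lam → 0 < β → 0 < γ → ∀ T : ℝ, 0 < T → ∀ (μ : MeasureTheory.Measure Literature.MathematicalPhysics.KineticTheory.HeatConduction.ChainConfig) (D : Literature.MathematicalPhysics.KineticTheory.HeatConduction.InfiniteChainDynamics (Literature.MathematicalPhysics.KineticTheory.HeatConduction.pinnedChain ω₂ lam β γ)), (Literature.MathematicalPhysics.KineticTheory.HeatConduction.pinnedChain ω₂ lam β γ).IsChainGibbsMeasure T μ → Literature.MathematicalPhysics.KineticTheory.HeatConduction.IsShiftInvariant μ → D.PreservesMeasure μ → (∀ t : ℝ, D.HasAbsConvergentCorrelation μ t) → ∀ t : ℝ, D.currentCorrelation μ (-t) = D.currentCorrelation μ t) →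
    (∀ ω₂ lam β γ : ℝ, 0 < ω₂ → 0 < lam → 0 < β → 0 < γ → ∀ T : ℝ, 0 < T → ∀ (μ : MeasureTheory.Measure Literature.MathematicalPhysics.KineticTheory.HeatConduction.ChainConfig) (D : Literature.MathematicalPhysics.KineticTheory.HeatConduction.InfiniteChainDynamics (Literature.MathematicalPhysics.KineticTheory.HeatConduction.pinnedChain ω₂ lam β γ)), (Literature.MathematicalPhysics.KineticTheory.HeatConduction.pinnedChain ω₂ lam β γ).IsChainGibbsMeasure T μ → Literature.MathematicalPhysics.KineticTheory.HeatConduction.IsShiftInvariant μ → D.PreservesMeasure μ → (∀ t : ℝ, D.HasAbsConvergentCorrelation μ t) → (∀ t : ℝ, D.currentCorrelation μ (-t) = D.currentCorrelation μ t) → ∀ t : ℝ, 0 < t → (∑' x : ℤ, ∫ σ, (∫ s in (0:ℝ)..t, (Literature.MathematicalPhysics.KineticTheory.HeatConduction.pinnedChain ω₂ lam β γ).bondCurrentZ (D.flow s σ) 0) * (∫ s in (0:ℝ)..t, (Literature.MathematicalPhysics.KineticTheory.HeatConduction.pinnedChain ω₂ lam β γ).bondCurrentZ (D.flow s σ) x)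 ∂μ) = 2 * ∫ u in Set.Ioc (0:ℝ) t, (t - u) * D.currentCorrelation μ u) →
    (∀ ω₂ lam β γ : ℝ, 0 < ω₂ → 0 < lam → 0 < β → 0 < γ → ∀ T : ℝ, 0 < T → ∀ (μ : MeasureTheory.Measure Literature.MathematicalPhysics.KineticTheory.HeatConduction.ChainConfig) (D : Literature.MathematicalPhysics.KineticTheory.HeatConduction.InfiniteChainDynamics (Literature.MathematicalPhysics.KineticTheory.HeatConduction.pinnedChain ω₂ lam β γ)), (Literature.MathematicalPhysics.KineticTheory.HeatConduction.pinnedChain ω₂ lam β γ).IsChainGibbsMeasure T μ → Literature.MathematicalPhysics.KineticTheory.HeatConduction.IsShiftInvariant μ → D.PreservesMeasure μ → (∀ t : ℝ, D.HasAbsConvergentCorrelation μ t) → ∃ c : ℝ, 0 < c ∧ ∀ᶠ t : ℝ in Filter.atTop, c * t ≤ ∑' x : ℤ, ∫ σ, (∫ s in (0:ℝ)..t, (Literature.MathematicalPhysics.KineticTheory.HeatConduction.pinnedChain ω₂ lam β γ).bondCurrentZ (D.flow s σ) 0) * (∫ s in (0:ℝ)..t, (Literature.MathematicalPhysics.KineticTheory.HeatConduction.pinnedChain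 ω₂ lam β γ).bondCurrentZ (D.flow s σ) x) ∂μ) →
    (∀ ω₂ lam β γ : ℝ, 0 < ω₂ → 0 < lam → 0 < β → 0 < γ → ∀ T : ℝ, 0 < T → ∀ (μ : MeasureTheory.Measure Literature.MathematicalPhysics.KineticTheory.HeatConduction.ChainConfig) (D : Literature.MathematicalPhysics.KineticTheory.HeatConduction.InfiniteChainDynamics (Literature.MathematicalPhysics.KineticTheory.HeatConduction.pinnedChain ω₂ lam β γ)), (Literature.MathematicalPhysics.KineticTheory.HeatConduction.pinnedChain ω₂ lam β γ).IsChainGibbsMeasure T μ → Literature.MathematicalPhysics.KineticTheory.HeatConduction.IsShiftInvariant μ → D.PreservesMeasure μ → (∀ t : ℝ, D.HasAbsConvergentCorrelation μ t) → MeasureTheory.IntegrableOn (D.currentCorrelation μ) (Set.Ioi 0) MeasureTheory.volume → 0 < D.greenKuboConductivity μ T) := by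
  intro hEven hEH hDiff ω₂ lam β γ hω hl hβ hγ T hT μ D hG hS hP hA hI
  have hev := hEven ω₂ lam β γ hω hl hβ hγ T hT μ D hG hS hP hA
  have hid := hEH ω₂ lam β γ hω hl hβ hγ T hT μ D hG hS hP hA hev
  obtain ⟨c, hc, hct⟩ := hDiff ω₂ lam β γ hω hl hβ hγ T hT μ D hG hS hP hA
  set C : ℝ → ℝ := D.currentCorrelation μ with hCdef
  -- Step 1: the diffusive bound in scaled one-sided form, eventually in `t`:
  --   c t ≤ V(t) = 2 ∫_{(0,t]} (t-u) C(u) du = t · ∫_{(0,∞)} (1 - r/t)⁺ 2C(r) dr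
  have h1 : ∀ᶠ t : ℝ in Filter.atTop, c ≤ ∫ r in Set.Ioi (0:ℝ), max (1 - r / t) 0 * (2 * C r) := by
    filter_upwards [hct, Filter.eventually_gt_atTop (0:ℝ)] with t hVt htpos
    rw [hid t htpos] at hVt
    have htwo : (2 * ∫ u in Set.Ioc (0:ℝ) t, (t - u) * C u)
        = ∫ r in Set.Ioc (0:ℝ) t, (t - r) * (2 * C r) := by
      rw [← MeasureTheory.integral_const_mul]
      congr 1
      funext r
      ring
    rw [htwo, ← integral_Ioi_max_sub_mul (fun r => 2 * C r) t] at hVt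
    have hscale : (∫ r in Set.Ioi (0:ℝ), max (1 - r / t) 0 * (2 * C r))
        = t⁻¹ * ∫ r in Set.Ioi (0:ℝ), max (t - r) 0 * (2 * C r) := by
      rw [← MeasureTheory.integral_const_mul]
      congr 1
      funext r
      have hmax : max (1 - r / t) 0 = t⁻¹ * max (t - r) 0 := by
        rw [mul_max_of_nonneg _ _ (inv_nonneg.mpr htpos.le), mul_zero]
        congr 1
        field_simp
      rw [hmax]
      ring
    rw [hscale, le_inv_mul_iff₀ htpos]
    linarith [hVt]
  -- Step 2: dominated convergence, `∫_0^∞ (1 - r/t)⁺ 2C(r) dr → ∫_0^∞ 2C(r) dr`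
  have h2 : Filter.Tendsto (fun t : ℝ => ∫ r in Set.Ioi (0:ℝ), max (1 - r / t) 0 * (2 * C r))
      Filter.atTop (nhds (∫ r in Set.Ioi (0:ℝ), 2 * C r)) := by
    refine MeasureTheory.tendsto_integral_filter_of_dominated_convergence (fun r => 2 * ‖C r‖) ?_ ?_ ?_ ?_
    · refine Filter.Eventually.of_forall fun t => ?_
      exact (((continuous_const.sub (continuous_id.div_const t)).max continuous_const).aestronglyMeasurable).mul
        (hI.integrable.aestronglyMeasurable.const_mul 2)
    · filter_upwards [Filter.eventually_gt_atTop (0:ℝ)] with t ht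
      filter_upwards [MeasureTheory.ae_restrict_mem measurableSet_Ioi] with r hr
      have h0 : 0 ≤ max (1 - r / t) 0 := le_max_right _ _
      have hr' : 0 ≤ r / t := div_nonneg (le_of_lt hr) ht.le
      have h1' : max (1 - r / t) 0 ≤ 1 := max_le (by linarith) zero_le_one
      have hn : ‖max (1 - r / t) 0 * (2 * C r)‖ = max (1 - r / t) 0 * (2 * ‖C r‖) := by
        rw [norm_mul, norm_mul, Real.norm_of_nonneg h0, Real.norm_of_nonneg (zero_le_two)]
      rw [hn]
      nlinarith [norm_nonneg (C r)]
    · exact hI.integrable.norm.const_mul 2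
    · refine Filter.Eventually.of_forall fun r => ?_
      have hlim : Filter.Tendsto (fun t : ℝ => max (1 - r / t) 0) Filter.atTop (nhds (max (1 - 0) 0)) :=
        (tendsto_const_nhds.sub (tendsto_const_nhds.div_atTop Filter.tendsto_id)).max tendsto_const_nhds
      have hone : max (1 - (0:ℝ)) 0 = 1 := by norm_num
      rw [hone] at hlim
      simpa using hlim.mul_const (2 * C r)
  -- Step 3: pass to the limit and conclude
  have h3 : c ≤ ∫ r in Set.Ioi (0:ℝ), 2 * C r := ge_of_tendsto h2 h1
  have h4 : 0 < ∫ r in Set.Ioi (0:ℝ), C r := by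
    rw [MeasureTheory.integral_const_mul] at h3
    linarith
  show 0 < (T ^ 2)⁻¹ * ∫ t in Set.Ioi (0:ℝ), D.currentCorrelation μ t
  exact mul_pos (inv_pos.mpr (pow_pos hT 2)) h4

/-- **Skeleton theorem — the crux `TangentFlowDephasing.NoSelfLocalization` BY NAME from the three registered
stubs** (the only theorem of this file concluding the crux; its `sorry`s are exactly those of
`stub_currentCorrelation_even`, `stub_einsteinHelfand`, `stub_diffusiveSpreading`; the seam is the sorry-free
`noSelfLocalization_of_stubs`). -/
theorem NoSelfLocalization_of :
    _root_.Summit.AtomisticToContinuum.FouriersLaw.Theses.TangentFlowDephasing.NoSelfLocalization :=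
  noSelfLocalization_of_stubs stub_currentCorrelation_even stub_einsteinHelfand stub_diffusiveSpreading

end Birth

end Summit.AtomisticToContinuum.FouriersLaw.Cruxes.NoSelfLocalization

end
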